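import Literature.AlgebraicGeometry.HodgeTheory.AtiyahClassCech
import Literature.AlgebraicGeometry.Modules.CechCup
import Literature.AlgebraicGeometry.Modules.CechEndCochainFamily
import Literature.AlgebraicGeometry.Modules.LocallyFreeTrace
import Literature.AlgebraicGeometry.Modules.AdaptedFrame
import HarnessLib

/-!
# The contraction of `ω ∪ At` in frames: `⟪T₀₂, d(T₂₀ N)⟫ - ⟪T₀₃, d(T₃₀ N)⟫`

Let `X` be an `S`-scheme, `E` a finite locally free `𝒪_X`-module with a framing `𝔣 = (U_a, e_a)`
(`Modules/CechEndCochain.lean`), `c` a matrix `2`-cochain of `𝔣` with local endomorphisms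
`ω = toLocalFamily c` (`Modules/CechEndCochainFamily.lean`) and `At = atiyahCocycle 𝔣` the Atiyah
`1`-cocycle of the framing (`HodgeTheory/AtiyahClassCech.lean`,
`At_{ab}(b_{b,l}) = Σ_i b_{a,i} ⊗ d(T_{ab})_{il}`). The `3`-cochain `ω ∪ At` (`Modules/CechCup.lean`) has
values in `E ⊗ Ω¹ = 𝓗om(E^∨, Ω¹)`; its CONTRACTION (`Modules/LocallyFreeTrace.lean`, the sheaf map
behind the trace with coefficients `Tr_{Ω¹} : Ext³(E, E ⊗ Ω¹) → H³(Ω¹)`, hence behind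
`σ₁ = Tr(At ∘ −)`) is computed here on every `3`-simplex `γ = (γ₀, γ₁, γ₂, γ₃)` in the frames:

  `c(ω ∪ At)_γ = ⟪T_{γ₀γ₂}, d(T_{γ₂γ₀} N)⟫ - ⟪T_{γ₀γ₃}, d(T_{γ₃γ₀} N)⟫`,  `N = X_{γ₀γ₁γ₂}|_{U_γ} · T_{γ₂γ₀}`
  (`contract_cupFamily_atiyahCocycle_toLocalFamily`),

where `⟪P, Q⟫ = Σ_{i,p} P_{ip} • Q_{pi}` (`smulTrace`: "`tr(PQ)`" of a matrix of functions against a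
matrix of `1`-forms), `d` is applied entrywise and all transition matrices are read over `U_γ`
(`Framing.faceT`, `Framing.frontMat`, `Framing.cupMatrix`). This is the classical local computation
of `σ₁`-type traces (Atiyah 1957 §4; Buchweitz–Flenner 2003 §3–4) and the only analytic input of the
additivity of `σ₁ ∘ ob` over short exact sequences, where all five matrices are block upper
triangular. Everything is proved; no named facts.

## References

* M. F. Atiyah, *Complex analytic connections in fibre bundles*, Trans. AMS 85 (1957), §4. [Atiyah1957]
* R.-O. Buchweitz, H. Flenner, *A semiregularity map for modules and applications to deformations*,
  Compositio Math. 137 (2003), §3, Prop. 4.2. [BuchweitzFlenner2003]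
-/

noncomputable section

universe u

open CategoryTheory CategoryTheory.Abelian AlgebraicGeometry Opposite TopologicalSpace Limits

/-! ### Matrices of a framing read over the open of a `3`-simplex -/

namespace Literature.AlgebraicGeometry.Modules

namespace Framing

variable {X : Scheme.{u}} {E : X.Modules} {ι : Type u} (𝔣 : Framing E ι)

/-- **`T_{γ_k γ_l}` over `U_γ`** for a `3`-simplex `γ`. [folklore] -/
abbrev faceT (γ : Fin 4 → ι) (k l : Fin 4) : Matrix (𝔣.I (γ k)) (𝔣.I (γ l)) Γ(X, face 𝔣.U γ) :=
  𝔣.T (γ k) (γ l) (face 𝔣.U γ) (face_le 𝔣.U γ k) (face_le 𝔣.U γ l)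

/-- **`X_{γ₀γ₁γ₂}|_{U_γ}`**: the matrix of a `2`-cochain on the front face of a `3`-simplex `γ`,
restricted to `U_γ` (typed over `I_{γ₀} × I_{γ₂}`). [folklore] -/
def frontMat (c : 𝔣.Cochain 2) (γ : Fin 4 → ι) : Matrix (𝔣.I (γ 0)) (𝔣.I (γ 2)) Γ(X, face 𝔣.U γ) :=
  c.mat (Cech.front γ) (face 𝔣.U γ) fun k => (Cech.face_le_face_front 𝔣.U γ).trans (face_le 𝔣.U _ k)

/-- **`N_γ = X_{γ₀γ₁γ₂}|_{U_γ} · T_{γ₂γ₀}`**: the matrix, in the frame `e_{γ₀}` over `U_γ`, of the local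
endomorphism `ω_{γ₀γ₁γ₂}` of the cochain. [folklore] -/
def cupMatrix (c : 𝔣.Cochain 2) (γ : Fin 4 → ι) : Matrix (𝔣.I (γ 0)) (𝔣.I (γ 0)) Γ(X, face 𝔣.U γ) :=
  𝔣.frontMat c γ * 𝔣.faceT γ 2 0

/-- **Coordinates of the values of `op_{az}(A)` on the basis of `e_a`**: the `e_a`-coordinates of
`op_{az}(A)(b_{a,x}|)` over `V' ≤ V` are the `x`-th column of `(A · T_{za})|_{V'}`. [folklore] -/
lemma coord_appLE_op_basisSection (a z : ι) (V : X.Opens) (ha : V ≤ 𝔣.U a) (hz : V ≤ 𝔣.U z)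
    (A : Matrix (𝔣.I a) (𝔣.I z) Γ(X, V)) {V' : X.Opens} (l : V' ⟶ V) (k : V' ⟶ 𝔣.U a)
    (x m : 𝔣.I a) :
    coord (𝔣.e a) k (appLE (𝔣.op a z V ha hz A) l (E.presheaf.map k.op (basisSection (𝔣.e a) x))) m =
      X.presheaf.map l.op ((A * 𝔣.T z a V hz ha) m x) := by
  obtain rfl : k = l ≫ homOfLE ha := Subsingleton.elim _ _
  rw [← presheaf_map_map, Framing.op, appLE_matrixEnd_basisSection', coord_sum_smul_basisSection]

/-- **The `e_{γ₀}`-coordinates of `ω_{γ₀γ₁γ₂}(b_{γ₀,i}|_{U_γ})` are the `i`-th column of `N_γ`.**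
[folklore] -/
lemma coord_appLE_toLocalFamily_front (c : 𝔣.Cochain 2) (γ : Fin 4 → ι)
    (kf : face 𝔣.U γ ⟶ face 𝔣.U (Cech.front γ)) (k₀ : face 𝔣.U γ ⟶ 𝔣.U (γ 0)) (i m : 𝔣.I (γ 0)) :
    coord (𝔣.e (γ 0)) k₀ (appLE (𝔣.toLocalFamily c (Cech.front γ)) kf
        (E.presheaf.map k₀.op (basisSection (𝔣.e (γ 0)) i))) m = 𝔣.cupMatrix c γ m i := by
  have h := 𝔣.coord_appLE_op_basisSection (Cech.front γ 0) (Cech.front γ (Fin.last 2))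
    (face 𝔣.U (Cech.front γ)) (face_le 𝔣.U (Cech.front γ) 0) (face_le 𝔣.U (Cech.front γ) (Fin.last 2))
    (c.mat (Cech.front γ) (face 𝔣.U (Cech.front γ)) (face_le 𝔣.U (Cech.front γ))) kf k₀ i m
  refine h.trans ?_
  obtain rfl : kf = homOfLE (Cech.face_le_face_front 𝔣.U γ) := Subsingleton.elim _ _
  change ((c.mat (Cech.front γ) (face 𝔣.U (Cech.front γ)) (face_le 𝔣.U (Cech.front γ)) *
      𝔣.T (Cech.front γ (Fin.last 2)) (Cech.front γ 0) (face 𝔣.U (Cech.front γ))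
        (face_le 𝔣.U (Cech.front γ) (Fin.last 2)) (face_le 𝔣.U (Cech.front γ) 0)).map
      (secRes X (Cech.face_le_face_front 𝔣.U γ))) m i = _
  rw [Matrix.map_mul, c.map_mat, 𝔣.T_map]
  rfl

end Framing

end Literature.AlgebraicGeometry.Modules

namespace Literature.AlgebraicGeometry.HodgeTheory

open Literature.AlgebraicGeometry.Modules Literature.AlgebraicGeometry.Motives

/-! ### The pairing `⟪P, Q⟫ = Σ_{i,p} P_{ip} • Q_{pi}` -/

section SmulTrace

variable {R : Type*} {M : Type*} [Semiring R] [AddCommMonoid M] [Module R M] {m n : Type*}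
  [Fintype m] [Fintype n]

/-- **`⟪P, Q⟫ = Σ_i Σ_p P_{ip} • Q_{pi}`**: the "trace of the product" of a matrix `P` of scalars
with a matrix `Q` of vectors (e.g. `1`-forms). [folklore] -/
def smulTrace (P : Matrix m n R) (Q : Matrix n m M) : M := ∑ i, ∑ p, P i p • Q p i

/-- `⟪P, Q⟫` is additive in `Q`. [folklore] -/
lemma smulTrace_add (P : Matrix m n R) (Q Q' : Matrix n m M) :
    smulTrace P (Q + Q') = smulTrace P Q + smulTrace P Q' := by
  simp only [smulTrace, Matrix.add_apply, smul_add, Finset.sum_add_distrib]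

/-- **The term `⟪P, d(Q N)⟫`** of the contraction formula (`d` applied entrywise). [folklore] -/
def cupTerm (d : R → M) (P : Matrix m n R) (Q : Matrix n m R) (N : Matrix m m R) : M :=
  smulTrace P ((Q * N).map d)

end SmulTrace

/-! ### Values of twisting terms on dual basis vectors -/

section Local

variable {S : Type u} [CommRing S] {X : Over (Spec (CommRingCat.of S))} {E : X.left.Modules}
  {W V : X.left.Opens} {I : Type u}

/-- **`δ(f, s)(μ) = μ(s) • df`** for `μ ∈ Γ(E^∨, W)` (as a value of `smulSection (df)`). [folklore] -/
lemma appLE_deltaHom_id (f : Γ(X.left, W)) (s : Γ(E, W)) (μ : E.over W ⟶ (unitModule X.left).over W) :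
    appLE (deltaHom E W f s) (𝟙 W) (μ : Γ(dual E, W)) =
      appLE (smulSection (dSection X W f)) (𝟙 W) (appLE μ (𝟙 W) s) := by
  unfold deltaHom
  rw [appLE_comp, appLE_evalAt, presheaf_map_id]

variable (e : SheafOfModules.free I ≅ E.over W)

/-- **`(Σ_p δ(f_p, b'_p|))(λ_i) = Σ_p T(e, e')_{ip} • d f_p`**: the value of a sum of twisting terms at
the restricted basis sections `b'_p|_W` of another frame `e'` on the `i`-th dual basis vector of `e`.
[folklore] -/
lemma appLE_sum_deltaHom_dualBasis {W' : X.left.Opens} {I' : Type u} [Fintype I']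
    (e' : SheafOfModules.free I' ≅ E.over W') (k' : W ⟶ W') (f : I' → Γ(X.left, W)) (i : I) :
    appLE (∑ p, deltaHom E W (f p) (E.presheaf.map k'.op (basisSection e' p))) (𝟙 W)
        (dualBasis e i : Γ(dual E, W)) =
      ∑ p, transition e e' (𝟙 W) k' i p • dSection X W (f p) := by
  rw [appLE_sum]
  refine Finset.sum_congr rfl fun p _ => ?_
  rw [appLE_deltaHom_id, appLE_smulSection, presheaf_map_id]
  rfl

end Local

/-! ### The contraction of `ω ∪ At` on a `3`-simplex -/

section Contract

variable {S : Type u} [CommRing S] {X : Over (Spec (CommRingCat.of S))} {E : X.left.Modules}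
  (hE : IsFiniteLocallyFree E) {ι : Type u} (𝔣 : Framing E ι)

/-- **The contraction of `ω ∪ At` on a `3`-simplex, in the frames**:
`c(ω ∪ At)_γ = ⟪T_{γ₀γ₂}, d(T_{γ₂γ₀} N_γ)⟫ - ⟪T_{γ₀γ₃}, d(T_{γ₃γ₀} N_γ)⟫`, `N_γ = X_{γ₀γ₁γ₂}|_{U_γ} T_{γ₂γ₀}`:
the value `ω_{γ₀γ₁γ₂}(b_{γ₀,i})` has `e_{γ₀}`-coordinates the `i`-th column of `N_γ`, hence
`e_{γ₂}`-coordinates the `i`-th column of `T_{γ₂γ₀} N_γ` (and `e_{γ₃}`-coordinates that of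
`T_{γ₃γ₀} N_γ`); `At_{γ₂γ₃}` of it is `Σ_p b_{γ₂,p} ⊗ d(T_{γ₂γ₀}N_γ)_{pi} - Σ_q b_{γ₃,q} ⊗ d(T_{γ₃γ₀}N_γ)_{qi}`,
and contracting against the dual basis vector `λ_{γ₀,i}` gives the two "traces".
[cite: Atiyah1957, §4] [cite: BuchweitzFlenner2003, §3] -/
theorem contract_cupFamily_atiyahCocycle_toLocalFamily (c : 𝔣.Cochain 2) (γ : Fin 4 → ι) :
    (contract hE (cotangentSheaf X)).app (face 𝔣.U γ)
        (Cech.cupFamily (atiyahCocycle 𝔣) (𝔣.toLocalFamily c) γ) =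
      cupTerm (dSection X (face 𝔣.U γ)) (𝔣.faceT γ 0 2) (𝔣.faceT γ 2 0) (𝔣.cupMatrix c γ) -
        cupTerm (dSection X (face 𝔣.U γ)) (𝔣.faceT γ 0 3) (𝔣.faceT γ 3 0) (𝔣.cupMatrix c γ) := by
  classical
  rw [contract_app_eq_frameContract hE _ (SheafOfModules.restrictTrivialisation
    (R := X.left.ringCatSheaf) (homOfLE (face_le 𝔣.U γ 0)) (𝔣.e (γ 0)))]
  unfold frameContract
  rw [cupTerm, cupTerm, smulTrace, smulTrace, ← Finset.sum_sub_distrib]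
  refine Finset.sum_congr rfl fun i _ => ?_
  rw [basisSection_restrictTrivialisation, Cech.appLE_cupFamily, appLE_atiyahCocycle,
    _root_.Literature.AlgebraicGeometry.HodgeTheory.appLE_sub', appLE_sum_deltaHom_dualBasis,
    appLE_sum_deltaHom_dualBasis]
  refine congrArg₂ (· - ·) (Finset.sum_congr rfl fun p _ => ?_) (Finset.sum_congr rfl fun q _ => ?_)
  · refine congrArg₂ (· • ·) ?_ ?_
    · rw [transition_apply, coord_restrictTrivialisation, ← transition_apply]
      exact congrArg₂ (fun k k' => transition (𝔣.e (γ 0)) (𝔣.e (γ 2)) k k' i p)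
        (Subsingleton.elim _ _) (Subsingleton.elim _ _)
    · rw [Matrix.map_apply]
      refine congrArg _ ?_
      rw [← coordVec_apply, coordVec_eq_transition_mulVec (𝔣.e (Cech.back 2 γ 0)) (𝔣.e (γ 0)) _
        (homOfLE (face_le 𝔣.U γ 0)), Matrix.mulVec, dotProduct, Matrix.mul_apply]
      refine Finset.sum_congr rfl fun m _ => ?_
      refine congrArg₂ (· * ·) ?_ ?_
      · exact congrArg₂ (fun k k' => transition (𝔣.e (γ 2)) (𝔣.e (γ 0)) k k' p m)
          (Subsingleton.elim _ _) (Subsingleton.elim _ _)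
      · rw [coordVec_apply]
        exact 𝔣.coord_appLE_toLocalFamily_front c γ _ _ i m
  · refine congrArg₂ (· • ·) ?_ ?_
    · rw [transition_apply, coord_restrictTrivialisation, ← transition_apply]
      exact congrArg₂ (fun k k' => transition (𝔣.e (γ 0)) (𝔣.e (γ 3)) k k' i q)
        (Subsingleton.elim _ _) (Subsingleton.elim _ _)
    · rw [Matrix.map_apply]
      refine congrArg _ ?_
      rw [← coordVec_apply, coordVec_eq_transition_mulVec (𝔣.e (Cech.back 2 γ 1)) (𝔣.e (γ 0)) _
        (homOfLE (face_le 𝔣.U γ 0)), Matrix.mulVec, dotProduct, Matrix.mul_apply]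
      refine Finset.sum_congr rfl fun m _ => ?_
      refine congrArg₂ (· * ·) ?_ ?_
      · exact congrArg₂ (fun k k' => transition (𝔣.e (γ 3)) (𝔣.e (γ 0)) k k' q m)
          (Subsingleton.elim _ _) (Subsingleton.elim _ _)
      · rw [coordVec_apply]
        exact 𝔣.coord_appLE_toLocalFamily_front c γ _ _ i m

end Contract

end Literature.AlgebraicGeometry.HodgeTheory

end
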